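import Summits.ValiantsHypothesis.ValiantsHypothesis.Theses.NumTame
import Literature.Computability.AlgebraicComplexity.ArithCircuitProofs
import Literature.Computability.AlgebraicComplexity.VNPeEqVNP

/-!
# Route NumTame — item 5389 `CoeffBoundA2` (Bürgisser's (A2) over `ℂ` with exported bounds)

Item `stmt-ValiantsHypothesis-5389` (support, rank 9): every `NP` language has a p-definable family
over `ℂ` with a Boolean part deciding it by positivity, whose degrees are `≤ r(n)` and whose
coefficients have modulus `≤ 2^{r(n)}`, `r` p-bounded.

**Proof** — not by re-running Part II of `BurgisserBooleanParts` with magnitude bookkeeping (the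
item's informal suggestion) but by MULTILINEARISING the tree's (A2) witness: from
`NP_booleanPart_VNP_holds ℂ` take `(f, φ, t)` and put

  `ML_n := ∑_{e ∈ {0,1}^n} f_n(e) · χ_e`,  `χ_e := ∏_i lit_{e_i}(x_i)`  (`lit_1(u) = u`, `lit_0(u) = 1 - u`,
  the tree's `litPoly`).

* `ML_n` agrees with `f_n` on the cube (`eval_boolPoint_multilin`), so `φ` is its Boolean part;
  `deg ML_n ≤ n`; `‖coeff_m ML_n‖ ≤ 2^n · 2^{t(n)} · 2^n` (`norm_coeff_prod_litPoly_le`: the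
  coefficients of `χ_e` have modulus `≤ 2^n`, induction with `coeff_X_mul'`), so `r(n) := 2n + t(n)`.
* `ML` is p-definable: with `f_n = ∑_{e'} g_n(x, e')` (`g ∈ VP`), `ML_n = ∑_e ∑_{e'} H_n(x, e, e')` for
  `H_n := g_n(y, e') · ∏_i EQ(y_i, x_i)` (`EQ` = the tree's `eqPoly`, `EQ(e_i, x_i) = lit_{e_i}(x_i)` on
  bits) — a nested Boolean sum, flattened by the tree's `boolSum_boolSum` (BCS Lemma (21.22)); `H` is a
  `VP` family (`complexity_eqPoly_le`, renaming and one product gate; degree `≤ deg g_n + 2n`).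

Honest framing: support item of a dormant route (cruxes `TameNF`, `BoolHyp` OPEN); Bürgisser 2000 TCS
§5 (A2) bookkeeping; nothing here bears on VP ≠ VNP (NOT proved).

References: P. Bürgisser, *Cook's versus Valiant's hypothesis*, TCS 235 (2000) §5 (A2), pp. 84–85;
Bürgisser–Clausen–Shokrollahi 1997, Lemma (21.22) (nested Boolean sums).
-/

-- layout Summits/ValiantsHypothesis/ValiantsHypothesis forces the duplicated namespace component
set_option linter.dupNamespace false

namespace Summit.ValiantsHypothesis.ValiantsHypothesis.Theorems.NumTame

open MvPolynomial Literature.Computability.AlgebraicComplexity Literature.Computability.Complexity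

/-! ### §1 The cube indicators `χ_e = ∏_i lit_{e_i}(x_i)` -/

/-- On the cube, `χ_e` is the indicator of the point `e`. -/
theorem eval_boolPoint_prod_litPoly {n : ℕ} (e x : Fin n → Bool) :
    eval (boolPoint ℂ x) (∏ i : Fin n, litPoly (e i) (X i : MvPolynomial (Fin n) ℂ)) =
      if e = x then 1 else 0 := by
  classical
  rw [map_prod, Finset.prod_congr rfl fun i _ =>
    eval_litPoly (boolPoint ℂ x) (e i) (x i) (X i) (by rw [eval_X]; rfl), Finset.prod_boole]
  simp [funext_iff]

/-- `deg χ_e ≤ n`. -/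
theorem totalDegree_prod_litPoly_le {n : ℕ} (e : Fin n → Bool) :
    (∏ i : Fin n, litPoly (e i) (X i : MvPolynomial (Fin n) ℂ)).totalDegree ≤ n :=
  calc (∏ i : Fin n, litPoly (e i) (X i : MvPolynomial (Fin n) ℂ)).totalDegree
      ≤ ∑ i : Fin n, (litPoly (e i) (X i : MvPolynomial (Fin n) ℂ)).totalDegree :=
        totalDegree_finsetProd _ _
    _ ≤ ∑ _i : Fin n, 1 := Finset.sum_le_sum fun i _ =>
        (totalDegree_litPoly_le _ _).trans (mvPolynomial_totalDegree_X_le_one _)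
    _ = n := by simp

/-- The coefficients of a product of `|s|` literals `x_i` / `1 - x_i` have modulus `≤ 2^{|s|}`. -/
theorem norm_coeff_prod_litPoly_le {n : ℕ} (e : Fin n → Bool) (s : Finset (Fin n))
    (m : Fin n →₀ ℕ) :
    ‖coeff m (∏ i ∈ s, litPoly (e i) (X i : MvPolynomial (Fin n) ℂ))‖ ≤ 2 ^ s.card := by
  classical
  induction s using Finset.induction_on generalizing m with
  | empty =>
    rw [Finset.prod_empty, Finset.card_empty, pow_zero, coeff_one]
    split_ifs <;> simp
  | insert a s ha ih =>
    rw [Finset.prod_insert ha, Finset.card_insert_of_notMem ha, pow_succ]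
    set P := ∏ i ∈ s, litPoly (e i) (X i : MvPolynomial (Fin n) ℂ) with hP
    have hX : ∀ m' : Fin n →₀ ℕ, ‖coeff m' (X a * P)‖ ≤ 2 ^ s.card := by
      intro m'
      rw [coeff_X_mul']
      split_ifs
      · exact ih _
      · rw [norm_zero]; positivity
    have hlit : litPoly (e a) (X a : MvPolynomial (Fin n) ℂ) = X a ∨
        litPoly (e a) (X a : MvPolynomial (Fin n) ℂ) = 1 - X a := by
      unfold litPoly; cases e a <;> simp
    have h2 : (0 : ℝ) ≤ 2 ^ s.card := by positivity
    rcases hlit with h | h <;> rw [h]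
    · calc ‖coeff m (X a * P)‖ ≤ 2 ^ s.card := hX m
        _ ≤ 2 ^ s.card * 2 := by linarith
    · rw [sub_mul, one_mul, coeff_sub]
      calc ‖coeff m P - coeff m (X a * P)‖ ≤ ‖coeff m P‖ + ‖coeff m (X a * P)‖ := norm_sub_le _ _
        _ ≤ 2 ^ s.card + 2 ^ s.card := add_le_add (ih m) (hX m)
        _ = 2 ^ s.card * 2 := by ring

/-! ### §2 The multilinearisation `ML(p) = ∑_e p(e) χ_e` -/

/-- `ML(p)` agrees with `p` on the cube. -/
theorem eval_boolPoint_multilin {n : ℕ} (p : MvPolynomial (Fin n) ℂ) (x : Fin n → Bool) :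
    eval (boolPoint ℂ x) (∑ e : Fin n → Bool, C (eval (boolPoint ℂ e) p) *
      ∏ i : Fin n, litPoly (e i) (X i : MvPolynomial (Fin n) ℂ)) = eval (boolPoint ℂ x) p := by
  classical
  rw [map_sum]
  simp_rw [map_mul, eval_C, eval_boolPoint_prod_litPoly, mul_ite, mul_one, mul_zero]
  simp

/-- `deg ML(p) ≤ n`. -/
theorem totalDegree_multilin_le {n : ℕ} (p : MvPolynomial (Fin n) ℂ) :
    (∑ e : Fin n → Bool, C (eval (boolPoint ℂ e) p) *
      ∏ i : Fin n, litPoly (e i) (X i : MvPolynomial (Fin n) ℂ)).totalDegree ≤ n :=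
  totalDegree_finsetSum_le fun e _ => (totalDegree_mul _ _).trans
    (by rw [totalDegree_C, zero_add]; exact totalDegree_prod_litPoly_le e)

/-- Coefficient bound for `ML(p)`: `‖coeff_m ML(p)‖ ≤ 2^n · B · 2^n` if `‖p(e)‖ ≤ B` on the cube. -/
theorem norm_coeff_multilin_le {n : ℕ} (p : MvPolynomial (Fin n) ℂ) {B : ℝ}
    (hB : ∀ e : Fin n → Bool, ‖eval (boolPoint ℂ e) p‖ ≤ B) (m : Fin n →₀ ℕ) :
    ‖coeff m (∑ e : Fin n → Bool, C (eval (boolPoint ℂ e) p) *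
      ∏ i : Fin n, litPoly (e i) (X i : MvPolynomial (Fin n) ℂ))‖ ≤ 2 ^ n * (B * 2 ^ n) := by
  classical
  rw [coeff_sum]
  calc ‖∑ e : Fin n → Bool, coeff m (C (eval (boolPoint ℂ e) p) *
          ∏ i : Fin n, litPoly (e i) (X i : MvPolynomial (Fin n) ℂ))‖
      ≤ ∑ e : Fin n → Bool, ‖coeff m (C (eval (boolPoint ℂ e) p) *
          ∏ i : Fin n, litPoly (e i) (X i : MvPolynomial (Fin n) ℂ))‖ := norm_sum_le _ _
    _ ≤ ∑ _e : Fin n → Bool, B * 2 ^ n := Finset.sum_le_sum fun e _ => by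
        rw [coeff_C_mul, norm_mul]
        have h := norm_coeff_prod_litPoly_le e Finset.univ m
        rw [Finset.card_univ, Fintype.card_fin] at h
        exact mul_le_mul (hB e) h (norm_nonneg _) ((norm_nonneg _).trans (hB e))
    _ = 2 ^ n * (B * 2 ^ n) := by
        rw [Finset.sum_const, Finset.card_univ, Fintype.card_fun, Fintype.card_bool,
          Fintype.card_fin, nsmul_eq_mul]
        push_cast
        ring

/-! ### §3 `ML(f)` is a nested Boolean sum over the `VP` witness of `f` -/

/-- Boolean sums are linear over factors without Boolean-sum variables. -/
theorem boolSum_mul_rename_inl {σ : Type*} {m : ℕ} (A : MvPolynomial (σ ⊕ Fin m) ℂ)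
    (B : MvPolynomial σ ℂ) : boolSum (A * rename Sum.inl B) = boolSum A * B := by
  unfold boolSum
  rw [Finset.sum_mul]
  refine Finset.sum_congr rfl fun e _ => ?_
  rw [map_mul, aeval_rename]
  have h : ((Sum.elim X fun j => if e j then (1 : MvPolynomial σ ℂ) else 0) ∘ Sum.inl) = X := by
    funext i; rfl
  rw [h, aeval_X_left, AlgHom.id_apply]

/-- Substituting bits for all variables gives the constant `C (p(e))`. -/
theorem aeval_bits_eq_C_eval {σ τ : Type*} (e : σ → Bool) (p : MvPolynomial σ ℂ) :
    aeval (fun j => if e j then (1 : MvPolynomial τ ℂ) else 0) p = C (eval (boolPoint ℂ e) p) := by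
  have h : (fun j => if e j then (1 : MvPolynomial τ ℂ) else 0) = fun j => C (boolPoint ℂ e j) := by
    funext j; simp only [boolPoint_apply]; split_ifs <;> simp
  rw [h, aeval_def, algebraMap_eq]
  change eval₂ C (⇑(C : ℂ →+* MvPolynomial τ ℂ) ∘ boolPoint ℂ e) p =
    C (eval₂ (RingHom.id ℂ) (boolPoint ℂ e) p)
  rw [eval₂_comp_left C (RingHom.id ℂ) (boolPoint ℂ e) p, RingHom.comp_id]

/-- On bits `e` for the `y`-variables, `∏_i EQ(y_i, x_i)` becomes the cube indicator `χ_e`. -/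
theorem aeval_bits_prod_eqPoly {n : ℕ} (e : Fin n → Bool) :
    aeval (Sum.elim X fun j => if e j then (1 : MvPolynomial (Fin n) ℂ) else 0)
      (∏ i : Fin n, eqPoly (X (Sum.inr i)) (X (Sum.inl i)) : MvPolynomial (Fin n ⊕ Fin n) ℂ) =
      ∏ i : Fin n, litPoly (e i) (X i : MvPolynomial (Fin n) ℂ) := by
  rw [map_prod]
  refine Finset.prod_congr rfl fun i _ => ?_
  unfold eqPoly litPoly
  simp only [map_add, map_mul, map_sub, map_one, aeval_X, Sum.elim_inr, Sum.elim_inl]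
  cases e i <;> simp

/-- **The nested Boolean sum.** With `H := g(y, e') · ∏_i EQ(y_i, x_i)`:
`∑_e ∑_{e'} H(x, e, e') = ML(∑_{e'} g(x, e'))`. -/
theorem boolSum_boolSum_witness {n u : ℕ} (g : MvPolynomial (Fin n ⊕ Fin u) ℂ) :
    boolSum (boolSum (rename (Sum.map (Sum.inr : Fin n → Fin n ⊕ Fin n) id) g *
      rename Sum.inl (∏ i : Fin n, eqPoly (X (Sum.inr i)) (X (Sum.inl i)) :
        MvPolynomial (Fin n ⊕ Fin n) ℂ))) =
      ∑ e : Fin n → Bool, C (eval (boolPoint ℂ e) (boolSum g)) *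
        ∏ i : Fin n, litPoly (e i) (X i : MvPolynomial (Fin n) ℂ) := by
  rw [boolSum_mul_rename_inl, boolSum_rename_sumMap]
  set F := boolSum g with hF
  unfold boolSum
  refine Finset.sum_congr rfl fun e _ => ?_
  rw [map_mul, aeval_rename]
  have h1 : ((Sum.elim X fun j => if e j then (1 : MvPolynomial (Fin n) ℂ) else 0) ∘ Sum.inr) =
      fun j => if e j then (1 : MvPolynomial (Fin n) ℂ) else 0 := by
    funext j; rfl
  rw [h1, aeval_bits_eq_C_eval, aeval_bits_prod_eqPoly]

/-! ### §4 Size and degree of the witness `H` -/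

/-- `L(∏_i EQ(y_i, x_i)) ≤ 8 n`. -/
theorem complexity_prod_eqPoly_le (n : ℕ) :
    complexity (∏ i : Fin n, eqPoly (X (Sum.inr i)) (X (Sum.inl i)) :
      MvPolynomial (Fin n ⊕ Fin n) ℂ) ≤ 8 * n := by
  calc complexity (∏ i : Fin n, eqPoly (X (Sum.inr i)) (X (Sum.inl i)) :
        MvPolynomial (Fin n ⊕ Fin n) ℂ)
      ≤ ∑ i : Fin n, complexity (eqPoly (X (Sum.inr i)) (X (Sum.inl i)) :
          MvPolynomial (Fin n ⊕ Fin n) ℂ) + (Finset.univ : Finset (Fin n)).card :=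
        complexity_finset_prod_le _ _
    _ ≤ ∑ _i : Fin n, 7 + (Finset.univ : Finset (Fin n)).card := by
        gcongr with i
        calc complexity (eqPoly (X (Sum.inr i)) (X (Sum.inl i)) : MvPolynomial (Fin n ⊕ Fin n) ℂ)
            ≤ 2 * (complexity (X (Sum.inr i) : MvPolynomial (Fin n ⊕ Fin n) ℂ) +
                complexity (X (Sum.inl i) : MvPolynomial (Fin n ⊕ Fin n) ℂ)) + 7 :=
              complexity_eqPoly_le _ _
          _ = 7 := by rw [complexity_X_holds, complexity_X_holds]
    _ = 8 * n := by simp; ring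

/-- `deg (∏_i EQ(y_i, x_i)) ≤ 2 n`. -/
theorem totalDegree_prod_eqPoly_le (n : ℕ) :
    (∏ i : Fin n, eqPoly (X (Sum.inr i)) (X (Sum.inl i)) :
      MvPolynomial (Fin n ⊕ Fin n) ℂ).totalDegree ≤ 2 * n :=
  calc (∏ i : Fin n, eqPoly (X (Sum.inr i)) (X (Sum.inl i)) :
        MvPolynomial (Fin n ⊕ Fin n) ℂ).totalDegree
      ≤ ∑ i : Fin n, (eqPoly (X (Sum.inr i)) (X (Sum.inl i)) :
          MvPolynomial (Fin n ⊕ Fin n) ℂ).totalDegree := totalDegree_finsetProd _ _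
    _ ≤ ∑ _i : Fin n, 2 := Finset.sum_le_sum fun i _ => (totalDegree_eqPoly_le _ _).trans
        (add_le_add (mvPolynomial_totalDegree_X_le_one _) (mvPolynomial_totalDegree_X_le_one _))
    _ = 2 * n := by simp; ring

/-! ### §5 The item -/

/-- **Item 5389 `CoeffBoundA2`** (the route decl, by name): Bürgisser's (A2) over `ℂ` with exported
degree and coefficient bounds, `r(n) = 2n + t(n)`. -/
theorem coeffBoundA2_proof : Theses.NumTame.CoeffBoundA2 := by
  classical
  intro L hL
  obtain ⟨f, φ, t, hf, hφ, hLφ⟩ := NP_booleanPart_VNP_holds ℂ L hL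
  obtain ⟨-, u, g, hg, hfg⟩ := hf
  refine ⟨fun n => ∑ e : Fin n → Bool, C (eval (boolPoint ℂ e) (f n)) *
      ∏ i : Fin n, litPoly (e i) (X i : MvPolynomial (Fin n) ℂ),
    φ, t, ?_, ⟨hφ.1, hφ.2.1, fun n x => ?_⟩, hLφ, fun n => 2 * n + t n, ?_, fun n => ⟨?_, fun m => ?_⟩⟩
  · -- p-definable: a nested Boolean sum over the VP witness `g` of `f`
    refine ⟨⟨⟨1, fun n => by simp⟩, IsPBounded.id.mono fun n => totalDegree_multilin_le (f n)⟩,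
      fun n => n + u n,
      fun n => rename ((Equiv.sumAssoc (Fin n) (Fin n) (Fin (u n))).trans
        (Equiv.sumCongr (Equiv.refl (Fin n)) finSumFinEquiv))
        (rename (Sum.map (Sum.inr : Fin n → Fin n ⊕ Fin n) id) (g n) *
          rename Sum.inl (∏ i : Fin n, eqPoly (X (Sum.inr i)) (X (Sum.inl i)) :
            MvPolynomial (Fin n ⊕ Fin n) ℂ)),
      ⟨⟨?_, ?_⟩, ?_⟩, fun n => ?_⟩
    · -- number of variables
      refine (IsPBounded.add_holds IsPBounded.id hg.1.1).mono fun n => ?_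
      simp only [Fintype.card_sum, Fintype.card_fin, id]
      omega
    · -- degree
      refine (IsPBounded.add_holds hg.1.2 (IsPBounded.mul_holds (IsPBounded.const 2)
        IsPBounded.id)).mono fun n => ?_
      refine (totalDegree_rename_le _ _).trans ((totalDegree_mul _ _).trans (add_le_add
        ((totalDegree_rename_le _ _).trans le_rfl)
        ((totalDegree_rename_le _ _).trans (totalDegree_prod_eqPoly_le n))))
    · -- complexity
      refine (IsPBounded.add_holds (IsPBounded.add_holds hg.2
        (IsPBounded.mul_holds (IsPBounded.const 8) IsPBounded.id)) (IsPBounded.const 1)).mono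
        fun n => ?_
      refine (complexity_rename_le_holds' _ _).trans ((complexity_mul_le_holds _ _).trans ?_)
      gcongr
      · exact complexity_rename_le_holds' _ _
      · exact (complexity_rename_le_holds' _ _).trans (complexity_prod_eqPoly_le n)
    · -- the Boolean-sum identity
      rw [← boolSum_boolSum, boolSum_boolSum_witness, ← hfg n]
  · -- Boolean part
    rw [eval_boolPoint_multilin]
    exact hφ.2.2 n x
  · -- `r` is p-bounded
    exact IsPBounded.add_holds (IsPBounded.mul_holds (IsPBounded.const 2) IsPBounded.id) hφ.1
  · -- degree bound
    exact (totalDegree_multilin_le (f n)).trans (by show n ≤ 2 * n + t n; omega)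
  · -- coefficient bound
    have hB : ∀ e : Fin n → Bool, ‖eval (boolPoint ℂ e) (f n)‖ ≤ (2 : ℝ) ^ t n := by
      intro e
      rw [hφ.2.2 n e, Complex.norm_natCast]
      exact_mod_cast (hφ.2.1 n e).le
    refine (norm_coeff_multilin_le (f n) hB m).trans (le_of_eq ?_)
    rw [← pow_add, ← pow_add]
    congr 1
    ring

end Summit.ValiantsHypothesis.ValiantsHypothesis.Theorems.NumTame
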